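import Literature.Barriers.ValiantsHypothesis.BDGIL24LieAlgebraAction
import Mathlib.LinearAlgebra.Dual.Lemmas
import HarnessLib

/-!
# "The action of `G` induces the action of `𝔤`": `GL_k`-stable spaces of metapolynomials are
# stable under the `gl_k`-action `lieOp` ([BDGIL24, §4 Claim 4.2, §5.1]) — PROVED
# (`BergEtAl2024.lieOp_mem_of_stable`, `BergEtAl2024.lieOp_mem_span_orbit`)

[BDGIL24] = M. van den Berg, P. Dutta, F. Gesmundo, C. Ikenmeyer, V. Lysikov, *Algebraic
metacomplexity and representation theory*, arXiv:2411.03444. §5.1.1 (p.27, PDF p.28,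
p0028.txt:L2–L6): "Let `V` be a representation of a complex reductive Lie group `G`. The action of
`G` on `V` induces the action of the corresponding Lie algebra `𝔤`." §5.1.2 (p0028:L28–L30): "`V` is
completely reducible as a representation of `𝔤`, with the same isotypic components as for `G`."
This file ties the tree's `lieOp` (the `gl_k`-action on metapolynomials, contragredient of
`lieDer`, `BDGIL24LieAlgebraAction.lean`) to the tree's GROUP action `coordRep (Fin k) ℂ d`
(`(g·F)(v) = F(g⁻¹ v)`): the one-parameter curves `t ↦ (g_t)·F` with `g_t⁻¹ = 1 + tN` are polynomial
in `t` with `t`-coefficient `−lieOp N F`, so every subspace stable under `GL_k` is stable under every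
`lieOp N` ("differentiate at `t = 0`"; the argument of the tree's `lieDer_mem_of_linSubst_mem`,
`LMR13TangentIsotypic.lean`, transported to metapolynomials).

* `eval_metaCurve` — `(metaCurve N F)(t) = coordRep g F` for the `g ∈ GL_k` with `g⁻¹ = 1 + tN`
  (whenever `det(1 + tN) ≠ 0`); `coeff_metaCurve_zero`, **`coeff_metaCurve_one`** (`= −lieOp N F`:
  the sign of the contragredient convention, now CHECKED against `coordRep`);
* `infinite_setOf_det_one_add_smul_ne_zero` — `det(1 + tN) ≠ 0` for all but finitely many `t`;
* **`lieOp_mem_of_stable`** — a `GL_k`-stable subspace `W` of metapolynomials is `lieOp N`-stable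
  for every `N ∈ gl_k`; **`lieOp_mem_span_orbit`** — `lieOp N Δ ∈ span(GL_k·Δ)`, hence (iterating)
  `U(gl_k)·Δ ⊆ span(GL_k·Δ)`, the space whose elements the tree bounds by
  `affComplexity_le_of_mem_span_orbit` (the orbit-span route to Thm. 1.1).

`metaCurve`, `formCurve`, `coeffPoly` are plumbing definitions (the curve as a polynomial in `t`).
Honest framing: representation-theoretic plumbing; nothing here bears on `VP ≠ VNP`.

## References
* [BergEtAl2024] arXiv:2411.03444, §5.1.1 p.27 (PDF p.28), §4 Claim 4.2 (p.13).
* [LandsbergManivelRessayre2013] §3.3–§3.4 (the `ε`-coefficient argument; tree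
  `lieDer_mem_of_linSubst_mem`).
-/

noncomputable section

open MvPolynomial
open scoped BigOperators

namespace Literature.Barriers.ValiantsHypothesis

namespace BergEtAl2024

open Literature.Computability.AlgebraicComplexity Literature.NumberTheory.DiophantineGeometry

variable {k d : ℕ}

/-! ### The curve `(1 + tN)·p` on forms, as a polynomial in `t` -/

/-- The curve `t ↦ (1 + tN)·p` on forms `ℂ[x₁,…,x_k]`, as a polynomial in `t` with form
coefficients: the algebra map `x_c ↦ x_c + t · D_N x_c` (plumbing; the tree's private `curvePoly` of
`LMR13TangentIsotypic.lean`). [cite: LandsbergManivelRessayre2013, §3.3 (p. 477)] -/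
def formCurve (N : Matrix (Fin k) (Fin k) ℂ) :
    MvPolynomial (Fin k) ℂ →ₐ[ℂ] Polynomial (MvPolynomial (Fin k) ℂ) :=
  MvPolynomial.aeval fun c => Polynomial.C (X c) + Polynomial.X * Polynomial.C (lieDer N (X c))

/-- The curve on a variable. [cite: LandsbergManivelRessayre2013, §3.3 (p. 477)] -/
theorem formCurve_X (N : Matrix (Fin k) (Fin k) ℂ) (c : Fin k) :
    formCurve N (X c) = Polynomial.C (X c) + Polynomial.X * Polynomial.C (lieDer N (X c)) := by
  rw [formCurve, MvPolynomial.aeval_X]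

/-- The curve on a constant. [cite: LandsbergManivelRessayre2013, §3.3 (p. 477)] -/
theorem formCurve_C (N : Matrix (Fin k) (Fin k) ℂ) (a : ℂ) :
    formCurve N (C a) = Polynomial.C (C a) := by
  rw [formCurve, MvPolynomial.aeval_C, Polynomial.algebraMap_apply, MvPolynomial.algebraMap_eq]

/-- Evaluating the curve at `t` gives the substitution `(1 + tN)·p`.
[cite: LandsbergManivelRessayre2013, §3.3 (p. 477)] -/
theorem eval_formCurve (N : Matrix (Fin k) (Fin k) ℂ) (t : ℂ) (p : MvPolynomial (Fin k) ℂ) :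
    (formCurve N p).eval (C t) = linSubst (Fin k) ℂ (1 + t • N) p := by
  induction p using MvPolynomial.induction_on with
  | C a => rw [formCurve_C, Polynomial.eval_C, linSubst_C]
  | add p q hp hq => rw [map_add, Polynomial.eval_add, hp, hq, map_add]
  | mul_X p c hp =>
    rw [map_mul, Polynomial.eval_mul, hp, map_mul, formCurve_X, Polynomial.eval_add,
      Polynomial.eval_mul, Polynomial.eval_C, Polynomial.eval_X, Polynomial.eval_C,
      linSubst_one_add_smul_X, MvPolynomial.smul_eq_C_mul]

/-- The constant coefficient of the curve is `p`. [cite: LandsbergManivelRessayre2013, §3.3 (p. 477)] -/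
theorem coeff_formCurve_zero (N : Matrix (Fin k) (Fin k) ℂ) (p : MvPolynomial (Fin k) ℂ) :
    (formCurve N p).coeff 0 = p := by
  rw [Polynomial.coeff_zero_eq_eval_zero, ← C_0, eval_formCurve, zero_smul, add_zero, linSubst_one,
    AlgHom.id_apply]

/-- The `t`-coefficient of `(1 + tN)·p` is `D_N p`. [cite: LandsbergManivelRessayre2013, §3.3 (p. 477)] -/
theorem coeff_formCurve_one (N : Matrix (Fin k) (Fin k) ℂ) (p : MvPolynomial (Fin k) ℂ) :
    (formCurve N p).coeff 1 = lieDer N p := by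
  induction p using MvPolynomial.induction_on with
  | C a => rw [formCurve_C, Polynomial.coeff_C, if_neg one_ne_zero, MvPolynomial.derivation_C]
  | add p q hp hq => rw [map_add, Polynomial.coeff_add, hp, hq, map_add]
  | mul_X p c hp =>
    rw [map_mul, formCurve_X, mul_add, ← mul_assoc, Polynomial.coeff_add, Polynomial.coeff_mul_C,
      Polynomial.coeff_mul_C, Polynomial.coeff_mul_X, hp, coeff_formCurve_zero, Derivation.leibniz,
      smul_eq_mul, smul_eq_mul]
    ring

/-! ### The curve on metapolynomials -/

/-- The scalar polynomial `t ↦ [x^ν]((1 + tN)·x^μ)` (plumbing). [cite: BergEtAl2024, §5.1.1, p.27 (PDF p.28)] -/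
def coeffPoly (N : Matrix (Fin k) (Fin k) ℂ) (ν μ : DegIdx (Fin k) d) : Polynomial ℂ :=
  ∑ j ∈ Finset.range ((formCurve N (monomial μ.1 (1 : ℂ))).natDegree + 1),
    Polynomial.monomial j (coeff ν.1 ((formCurve N (monomial μ.1 (1 : ℂ))).coeff j))

/-- Coefficients of `coeffPoly`. [cite: BergEtAl2024, §5.1.1, p.27 (PDF p.28)] -/
theorem coeff_coeffPoly (N : Matrix (Fin k) (Fin k) ℂ) (ν μ : DegIdx (Fin k) d) (j : ℕ) :
    (coeffPoly N ν μ).coeff j = coeff ν.1 ((formCurve N (monomial μ.1 (1 : ℂ))).coeff j) := by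
  rw [coeffPoly, Polynomial.finsetSum_coeff]
  simp only [Polynomial.coeff_monomial, Finset.sum_ite_eq', Finset.mem_range]
  split_ifs with h
  · rfl
  · rw [Polynomial.coeff_eq_zero_of_natDegree_lt (by omega), coeff_zero]

/-- Values of `coeffPoly`: `coeffPoly N ν μ (t) = [x^ν]((1 + tN)·x^μ)`.
[cite: BergEtAl2024, §5.1.1, p.27 (PDF p.28)] -/
theorem eval_coeffPoly (N : Matrix (Fin k) (Fin k) ℂ) (ν μ : DegIdx (Fin k) d) (t : ℂ) :
    (coeffPoly N ν μ).eval t = coeff ν.1 (linSubst (Fin k) ℂ (1 + t • N) (monomial μ.1 (1 : ℂ))) := by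
  rw [← eval_formCurve, Polynomial.eval_eq_sum_range (p := formCurve N (monomial μ.1 1)) (C t),
    coeff_sum, coeffPoly, Polynomial.eval_finsetSum]
  refine Finset.sum_congr rfl fun j _ => ?_
  rw [Polynomial.eval_monomial, ← C_pow, mul_comm ((formCurve N _).coeff j), coeff_C_mul, mul_comm]

/-- The curve `t ↦ g_t · F` on metapolynomials (`g_t⁻¹ = 1 + tN`, in the convention of `coordRep`)
as a polynomial in `t` with metapolynomial coefficients: the algebra map
`c_ν ↦ Σ_μ [x^ν]((1 + tN)·x^μ) · c_μ` (plumbing). [cite: BergEtAl2024, §5.1.1, p.27 (PDF p.28)] -/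
def metaCurve (N : Matrix (Fin k) (Fin k) ℂ) :
    MvPolynomial (DegIdx (Fin k) d) ℂ →ₐ[ℂ] Polynomial (MvPolynomial (DegIdx (Fin k) d) ℂ) :=
  MvPolynomial.aeval fun ν => ∑ μ : DegIdx (Fin k) d,
    Polynomial.map (C : ℂ →+* MvPolynomial (DegIdx (Fin k) d) ℂ) (coeffPoly N ν μ) *
      Polynomial.C (X μ)

/-- The curve on a coordinate. [cite: BergEtAl2024, §5.1.1, p.27 (PDF p.28)] -/
theorem metaCurve_X (N : Matrix (Fin k) (Fin k) ℂ) (ν : DegIdx (Fin k) d) :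
    metaCurve N (X ν) = ∑ μ : DegIdx (Fin k) d,
      Polynomial.map (C : ℂ →+* MvPolynomial (DegIdx (Fin k) d) ℂ) (coeffPoly N ν μ) *
        Polynomial.C (X μ) := by
  rw [metaCurve, MvPolynomial.aeval_X]

/-- The curve on a constant. [cite: BergEtAl2024, §5.1.1, p.27 (PDF p.28)] -/
theorem metaCurve_C (N : Matrix (Fin k) (Fin k) ℂ) (a : ℂ) :
    metaCurve (d := d) N (C a) = Polynomial.C (C a) := by
  rw [metaCurve, MvPolynomial.aeval_C, Polynomial.algebraMap_apply, MvPolynomial.algebraMap_eq]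

/-- Coefficients of the curve on a coordinate: `[t^j] metaCurve N c_ν = Σ_μ [x^ν][t^j]((1+tN)·x^μ) · c_μ`.
[cite: BergEtAl2024, §5.1.1, p.27 (PDF p.28)] -/
theorem coeff_metaCurve_X (N : Matrix (Fin k) (Fin k) ℂ) (ν : DegIdx (Fin k) d) (j : ℕ) :
    (metaCurve N (X ν)).coeff j = ∑ μ : DegIdx (Fin k) d,
      coeff ν.1 ((formCurve N (monomial μ.1 (1 : ℂ))).coeff j) • (X μ : MvPolynomial _ ℂ) := by
  rw [metaCurve_X, Polynomial.finsetSum_coeff]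
  refine Finset.sum_congr rfl fun μ _ => ?_
  rw [Polynomial.coeff_mul_C, Polynomial.coeff_map, coeff_coeffPoly, MvPolynomial.smul_eq_C_mul]

/-- **Evaluating the curve**: for `det(1 + tN) ≠ 0` and `g ∈ GL_k` the matrix with `g⁻¹ = 1 + tN`,
`(metaCurve N F)(t) = g·F` in the tree's `coordRep`. [cite: BergEtAl2024, §5.1.1, p.27 (PDF p.28)] -/
theorem eval_metaCurve (N : Matrix (Fin k) (Fin k) ℂ) (t : ℂ) (ht : (1 + t • N).det ≠ 0)
    (F : MvPolynomial (DegIdx (Fin k) d) ℂ) :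
    (metaCurve N F).eval (C t) =
      coordRep (Fin k) ℂ d (Matrix.GeneralLinearGroup.mkOfDetNeZero (1 + t • N) ht)⁻¹ F := by
  induction F using MvPolynomial.induction_on with
  | C a =>
    rw [metaCurve_C, Polynomial.eval_C, coordRep_apply]
    exact ((coordSubst d _).commutes a).symm
  | add p q hp hq => rw [map_add, Polynomial.eval_add, hp, hq, map_add]
  | mul_X p ν hp =>
    rw [map_mul, Polynomial.eval_mul, hp, coordRep_apply, coordRep_apply, map_mul, metaCurve_X,
      Polynomial.eval_finsetSum, coordSubst_X, inv_inv]
    congr 1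
    refine Finset.sum_congr rfl fun μ _ => ?_
    rw [Polynomial.eval_mul, Polynomial.eval_C, Polynomial.eval_map, Polynomial.eval₂_hom,
      eval_coeffPoly, linSubstRep_apply, Matrix.GeneralLinearGroup.val_mkOfDetNeZero,
      MvPolynomial.smul_eq_C_mul]

/-- The constant coefficient of the curve is `F`. [cite: BergEtAl2024, §5.1.1, p.27 (PDF p.28)] -/
theorem coeff_metaCurve_zero (N : Matrix (Fin k) (Fin k) ℂ) (F : MvPolynomial (DegIdx (Fin k) d) ℂ) :
    (metaCurve N F).coeff 0 = F := by
  induction F using MvPolynomial.induction_on with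
  | C a => rw [metaCurve_C, Polynomial.coeff_C_zero]
  | add p q hp hq => rw [map_add, Polynomial.coeff_add, hp, hq]
  | mul_X p ν hp =>
    rw [map_mul, Polynomial.mul_coeff_zero, hp, coeff_metaCurve_X, Finset.sum_eq_single ν]
    · rw [coeff_formCurve_zero, coeff_monomial, if_pos rfl, one_smul]
    · intro μ _ hμ
      rw [coeff_formCurve_zero, coeff_monomial, if_neg (fun h => hμ (Subtype.ext h)), zero_smul]
    · intro h
      exact absurd (Finset.mem_univ ν) h

/-- **The `t`-coefficient of the curve is `−lieOp N F`** (the derivative of `g_t·F` at `t = 0`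
along `g_t⁻¹ = 1 + tN`, `ġ_0 = −N`): the contragredient sign convention of `lieOp` checked against
`coordRep`. [cite: BergEtAl2024, §5.1.1 ("The action of G on V induces the action of 𝔤"), p.27 (PDF p.28)] locator: paper:arxiv-2411.03444 p0028.txt:L2–L6 -/
theorem coeff_metaCurve_one (N : Matrix (Fin k) (Fin k) ℂ) (F : MvPolynomial (DegIdx (Fin k) d) ℂ) :
    (metaCurve N F).coeff 1 = -lieOp k d N F := by
  induction F using MvPolynomial.induction_on with
  | C a =>
    rw [metaCurve_C, Polynomial.coeff_C, if_neg one_ne_zero, MvPolynomial.derivation_C, neg_zero]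
  | add p q hp hq => rw [map_add, Polynomial.coeff_add, hp, hq, map_add, neg_add]
  | mul_X p ν hp =>
    have h1 : (metaCurve N (X ν)).coeff 1 = -lieOp k d N (X ν) := by
      rw [coeff_metaCurve_X, lieOp_X, neg_neg]
      exact Finset.sum_congr rfl fun μ _ => by rw [coeff_formCurve_one]
    rw [map_mul, Polynomial.coeff_mul, Finset.Nat.sum_antidiagonal_succ, Finset.Nat.antidiagonal_zero,
      Finset.sum_singleton, zero_add, hp, h1, coeff_metaCurve_zero, coeff_metaCurve_zero,
      Derivation.leibniz, smul_eq_mul, smul_eq_mul]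
    ring

/-! ### `det(1 + tN) ≠ 0` for all but finitely many `t` -/

/-- The set of `t` with `det(1 + tN) ≠ 0` is infinite (its complement is the zero set of a
nonzero polynomial): the one-parameter family `g_t⁻¹ = 1 + tN` lies in `GL_k` for all but finitely
many `t`. [cite: LandsbergManivelRessayre2013, §3.3 (p. 477)] -/
private theorem infinite_setOf_det_one_add_smul_ne_zero (N : Matrix (Fin k) (Fin k) ℂ) :
    {t : ℂ | (1 + t • N).det ≠ 0}.Infinite := by
  -- the polynomial `det(1 + T N)`
  set P : Polynomial ℂ :=
    (1 + (Polynomial.X : Polynomial ℂ) • N.map (Polynomial.C : ℂ →+* Polynomial ℂ)).det with hP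
  have heval : ∀ t : ℂ, P.eval t = (1 + t • N).det := by
    intro t
    rw [hP, ← Polynomial.coe_evalRingHom, RingHom.map_det]
    congr 1
    ext i j
    simp only [RingHom.mapMatrix_apply, Matrix.map_apply, Matrix.add_apply, Matrix.smul_apply,
      Matrix.one_apply, smul_eq_mul, Polynomial.coe_evalRingHom, Polynomial.eval_add,
      Polynomial.eval_mul, Polynomial.eval_X, Polynomial.eval_C, apply_ite (Polynomial.eval t),
      Polynomial.eval_one, Polynomial.eval_zero]
  have hP0 : P ≠ 0 := by
    intro h
    have h0 := heval 0
    rw [h, Polynomial.eval_zero, zero_smul, add_zero, Matrix.det_one] at h0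
    exact zero_ne_one h0
  have hfin : {t : ℂ | (1 + t • N).det = 0}.Finite := by
    refine (Polynomial.finite_setOf_isRoot hP0).subset fun t ht => ?_
    rw [Set.mem_setOf_eq, Polynomial.IsRoot.def, heval]
    exact ht
  have : {t : ℂ | (1 + t • N).det ≠ 0} = {t : ℂ | (1 + t • N).det = 0}ᶜ := by
    ext t
    simp
  rw [this]
  exact hfin.infinite_compl

/-! ### From group stability to Lie-algebra stability -/

/-- **"The action of `G` on `V` induces the action of `𝔤`"**: a subspace of metapolynomials stable
under `coordRep (Fin k) ℂ d g` for every `g ∈ GL_k` is stable under `lieOp N` for every `N ∈ gl_k`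
(the `t`-coefficient of the polynomial curve `g_t·F`, `g_t⁻¹ = 1 + tN`, lies in the subspace:
a linear form vanishing on the subspace kills every coefficient of a polynomial with infinitely
many values in it). [cite: BergEtAl2024, §5.1.1, p.27 (PDF p.28)] locator: paper:arxiv-2411.03444 p0028.txt:L2–L6 -/
theorem lieOp_mem_of_stable (W : Submodule ℂ (MvPolynomial (DegIdx (Fin k) d) ℂ))
    (hW : ∀ g : GL (Fin k) ℂ, W ≤ W.comap (coordRep (Fin k) ℂ d g)) (N : Matrix (Fin k) (Fin k) ℂ)
    {F : MvPolynomial (DegIdx (Fin k) d) ℂ} (hF : F ∈ W) : lieOp k d N F ∈ W := by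
  classical
  by_contra hnot
  have hnot' : -lieOp k d N F ∉ W := fun h => hnot (by simpa using W.neg_mem h)
  obtain ⟨φ, hφ, hφW⟩ := Submodule.exists_dual_map_eq_bot_of_notMem hnot' inferInstance
  have hφW' : ∀ x ∈ W, φ x = 0 := fun x hx => by
    have : φ x ∈ W.map φ := Submodule.mem_map_of_mem hx
    rwa [hφW, Submodule.mem_bot] at this
  -- the scalar polynomial `q(t) = φ(g_t · F)`
  set Q := metaCurve N F with hQ
  set q : Polynomial ℂ := ∑ j ∈ Finset.range (Q.natDegree + 2), Polynomial.monomial j (φ (Q.coeff j))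
    with hq
  have hqeval : ∀ t : ℂ, q.eval t = φ (Q.eval (C t)) := fun t => by
    rw [Polynomial.eval_eq_sum_range' (Nat.lt_succ_of_lt (Nat.lt_succ_self _)) (C t), map_sum, hq,
      Polynomial.eval_finsetSum]
    refine Finset.sum_congr rfl fun j _ => ?_
    rw [Polynomial.eval_monomial, ← map_pow, mul_comm (Q.coeff j), ← MvPolynomial.smul_eq_C_mul,
      map_smul, smul_eq_mul, mul_comm]
  have hq0 : q = 0 := by
    refine Polynomial.eq_zero_of_infinite_isRoot q
      ((infinite_setOf_det_one_add_smul_ne_zero N).mono fun t ht => ?_)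
    rw [Set.mem_setOf_eq, Polynomial.IsRoot.def, hqeval, hQ, eval_metaCurve N t ht]
    exact hφW' _ (hW _ hF)
  have hq1 : q.coeff 1 = φ (-lieOp k d N F) := by
    rw [hq, Polynomial.finsetSum_coeff]
    simp only [Polynomial.coeff_monomial, Finset.sum_ite_eq', Finset.mem_range]
    rw [if_pos (by omega), hQ, coeff_metaCurve_one]
  rw [hq0, Polynomial.coeff_zero] at hq1
  exact hφ hq1.symm

/-- In particular **`lieOp N Δ ∈ span(GL_k · Δ)`** for every metapolynomial `Δ` and every
`N ∈ gl_k`; iterating, `U(gl_k)·Δ ⊆ span(GL_k·Δ)` — every `P.Δ` of §5 lies in the orbit span, whose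
elements the tree bounds by `affComplexity_le_of_mem_span_orbit`.
[cite: BergEtAl2024, §5.1.1, p.27 (PDF p.28)] -/
theorem lieOp_mem_span_orbit (N : Matrix (Fin k) (Fin k) ℂ) (Δ : MvPolynomial (DegIdx (Fin k) d) ℂ)
    {F : MvPolynomial (DegIdx (Fin k) d) ℂ}
    (hF : F ∈ Submodule.span ℂ (Set.range fun h : GL (Fin k) ℂ => coordRep (Fin k) ℂ d h Δ)) :
    lieOp k d N F ∈ Submodule.span ℂ (Set.range fun h : GL (Fin k) ℂ => coordRep (Fin k) ℂ d h Δ) :=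
  lieOp_mem_of_stable _ (span_orbit_le_comap Δ) N hF

end BergEtAl2024

end Literature.Barriers.ValiantsHypothesis
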